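import Mathlib
import Literature.Analysis.FluidPDE.Tao2016AveragedNS.RestartedCascadeFlows
import HarnessLib

/-!
# `BarrierSoundness`, stub `stub_base` (registered skeleton of item stmt-NavierStokesRegularity-23421,
  route `BarrierStepRungThree`): the certificate's datum clauses put Tao's one-shell datum in the
  description `P`

The route's description is `P(S, F) := v(win S) ≤ 0 ∧ 0 < g(win S) ∧ F ≥ 0 ∧ (outside-window energies
≤ r²/2) ∧ (∃ B, F ≤ B)`. At the rescaled one-shell datum (`datumState`, `datumEnergy`) the first two
conjuncts are clauses of the certificate, the energies `(if k = 0 then X₀ i²/2 else 0)/|X₀ i₀|²` are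
nonnegative and bounded, and they vanish at every shell outside the window `[kLo, kLo+n) ∋ 0` (the
window contains the datum shell `0` because `kLo ≤ 0` and `kLo + n ≥ 2`). This is the BASE conjunct of
`BarrierSoundness`; the signature below is the registered stub `stub_base` verbatim (all certificate
clauses as hypotheses, most of them unused here).

HONEST FRAMING: bookkeeping about Tao-type MODEL lattice states (Tao 2016 §6.2 (6.9)–(6.10)); nothing
here is a statement about the Navier–Stokes equations; the route's rung leaf (`TaoLadderRungThree.Target`,
TL-M3) is not the summit Statement, and this stub does not touch the load-bearing (step) conjunct.
-/

noncomputable section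

-- the sub-problem namespace `Summit.NavierStokesRegularity.NavierStokesRegularity` repeats the summit name by design (D-0017)
set_option linter.dupNamespace false

namespace Summit.NavierStokesRegularity.NavierStokesRegularity.Theorems

namespace BarrierSoundness

open Literature.Analysis.FluidPDE Literature.Analysis.FluidPDE.TaoCascade

/-- **Stub `stub_base` of item stmt-NavierStokesRegularity-23421** (`BarrierSoundness`, BASE conjunct):
for all certificate data, the description `P` holds at the rescaled one-shell datum — `v ≤ 0 < g` there
are clauses, the datum energies are nonnegative, vanish outside the window (which contains shell `0`),
and are bounded by `(∑ᵢ X₀ i²/2)/|X₀ i₀|²`. [cite: Tao2016AveragedNS, §6.2 (6.9)–(6.10) with §4 (4.6)–(4.7)] -/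
theorem stub_base : ∀ (R θ c η γ M : ℝ) (i₀ : Fin 4) (α : Fin 4 → Fin 4 → Fin 4 → ℤ × ℤ × ℤ → ℝ) (X₀ : Fin 4 → ℝ) (n : ℕ) (kLo : ℤ) (v g : (Fin 4 → Fin n → ℝ) → ℝ) (r q ρ env Ψ : ℤ → ℝ) (Φ : Fin n → ℝ) (win : (Fin 4 → ℤ → ℝ) → (Fin 4 → Fin n → ℝ)) (vf : (Fin 4 → ℤ → ℝ) → (Fin 4 → ℤ → ℝ)), 1 ≤ R ∧ Literature.Analysis.FluidPDE.TaoCascade.InTableClass R α ∧ X₀ i₀ ≠ 0 ∧ 0 ≤ θ ∧ θ ≤ 1 / 2 ∧ 0 < c ∧ 0 < η ∧ 0 < γ ∧ kLo ≤ 0 ∧ (2 : ℤ) ≤ kLo + n ∧ (∀ (S : Fin 4 → ℤ → ℝ) (i : Fin 4) (j : Fin n), win S i j = S i (kLo + (j : ℕ))) ∧ (∀ (S : Fin 4 → ℤ → ℝ) (i : Fin 4) (k : ℤ), vf S i k = Literature.Analysis.FluidPDE.TaoCascade.quadTerm 1 α (fun i' k' (_ : ℝ) => S i' k') i k 0) ∧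 ContDiff ℝ 1 v ∧ Continuous g ∧ (∀ (L' : ℕ) (k : ℤ), Literature.Analysis.FluidPDE.TaoCascade.slackWeight 1 θ c env L' k ≤ Ψ k) ∧ (∀ k : ℤ, 0 ≤ r k ∧ r k < q k ∧ 0 ≤ ρ k ∧ r k + c * ρ k ≤ q k ∧ q k ^ 2 / 2 ≤ env k) ∧ (∀ j : Fin n, 0 ≤ Φ j ∧ Φ j ≤ env (kLo + (j : ℕ)) ∧ M ^ 2 / 2 + η * Ψ (kLo + (j : ℕ)) + η * (1 + 1 : ℝ) ^ ((2 : ℝ) * ((kLo + (j : ℕ) : ℤ) : ℝ)) * c * Φ j < Φ j) ∧ (∃ M₁ : ℝ, ∀ k : ℤ, kLo + n ≤ k → (1 + (1 + 1 : ℝ) ^ ((10 : ℝ) * (k : ℝ))) * q k ≤ M₁) ∧ v (win (Literature.Analysis.FluidPDE.TaoCascade.datumState i₀ X₀)) ≤ 0 ∧ 0 < g (win (Literature.Analysis.FluidPDE.TaoCascade.datumState i₀ X₀)) ∧ (∀ x : Fin 4 → Fin n → ℝ, v x ≤ 0 → ∀ i j, |x i j| ≤ M) ∧ (∀ x : Fin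 4 → Fin n → ℝ, v x ≤ 0 → 0 < g x → -(γ * c) < v x) ∧ (∀ (S F : Fin 4 → ℤ → ℝ) (d : Fin 4 → Fin n → ℝ), (v (win S) ≤ 0 ∧ (∀ i k, S i k ^ 2 ≤ 2 * F i k) ∧ (∀ i k, 0 ≤ F i k) ∧ (∀ i k, (k < kLo ∨ kLo + n ≤ k) → F i k ≤ q k ^ 2 / 2) ∧ (∀ (i : Fin 4) (j : Fin n), F i (kLo + (j : ℕ)) ≤ Φ j)) → 0 < g (win S) → (∀ (i : Fin 4) (j : Fin n), |d i j| ≤ η * (1 + 1 : ℝ) ^ ((2 : ℝ) * ((kLo + (j : ℕ) : ℤ) : ℝ)) * Real.sqrt (Φ j)) → (fderiv ℝ v (win S)) (fun i j => vf S i (kLo + (j : ℕ)) + d i j) ≤ -γ) ∧ (∀ (S F : Fin 4 → ℤ → ℝ), (v (win S) ≤ 0 ∧ (∀ i k, S i k ^ 2 ≤ 2 * F i k) ∧ (∀ i k, 0 ≤ F i k) ∧ (∀ i k, (k < kLo ∨ kLo + n ≤ k) → F i k ≤ q k ^ 2 / 2) ∧ (∀ (i : Fin 4) (j : Fin n), F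 i (kLo + (j : ℕ)) ≤ Φ j)) → ∀ (i : Fin 4) (k : ℤ), (k < kLo ∨ kLo + n ≤ k) → vf S i k * S i k ≤ ρ k * |S i k|) ∧ (∀ (S F : Fin 4 → ℤ → ℝ), (v (win S) ≤ 0 ∧ (∀ i k, S i k ^ 2 ≤ 2 * F i k) ∧ (∀ i k, 0 ≤ F i k) ∧ (∀ i k, (k < kLo ∨ kLo + n ≤ k) → F i k ≤ q k ^ 2 / 2) ∧ (∀ (i : Fin 4) (j : Fin n), F i (kLo + (j : ℕ)) ≤ Φ j)) → g (win S) ≤ 0 → (1 + 1 : ℝ) ^ (-θ) ≤ |S i₀ 1| ∧ v (win (fun i k => S i (1 + k) / |S i₀ 1|)) ≤ 0 ∧ 0 < g (win (fun i k => S i (1 + k) / |S i₀ 1|)) ∧ (∀ i k, (k < kLo ∨ kLo + n ≤ k) → F i (1 + k) / |S i₀ 1| ^ 2 ≤ r k ^ 2 / 2)) → (fun S F => v (win S) ≤ 0 ∧ 0 < g (win S) ∧ (∀ i k, 0 ≤ F i k) ∧ (∀ i k, (k < kLo ∨ kLo + n ≤ k) → F i k ≤ r k ^ 2 / 2) ∧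 ∃ B : ℝ, ∀ i k, F i k ≤ B) (Literature.Analysis.FluidPDE.TaoCascade.datumState i₀ X₀) (Literature.Analysis.FluidPDE.TaoCascade.datumEnergy i₀ X₀) := by
  intro R θ c η γ M i₀ α X₀ n kLo v g r q ρ env Ψ Φ win vf h
  obtain ⟨-, -, -, -, -, -, -, -, hkLo, hkn, -, -, -, -, -, hprof, -, -, hv0, hg0, -⟩ := h
  refine ⟨hv0, hg0, ?_, ?_, ?_⟩
  · -- nonnegativity of the datum energies
    intro i k
    rw [datumEnergy_apply]
    split_ifs <;> positivity
  · -- outside the window the datum energies vanish (`k ≠ 0` there)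
    intro i k hk
    have hk0 : k ≠ 0 := by
      rintro rfl
      rcases hk with hk | hk
      · exact absurd hkLo (not_le.mpr hk)
      · have : (2 : ℤ) ≤ 0 := le_trans hkn (by exact_mod_cast hk)
        exact absurd this (by norm_num)
    rw [datumEnergy_apply, if_neg hk0, zero_div]
    have := (hprof k).1
    positivity
  · -- boundedness
    refine ⟨(∑ i, (1 / 2) * X₀ i ^ 2) / |X₀ i₀| ^ 2, fun i k => ?_⟩
    rw [datumEnergy_apply]
    have hsum : (1 / 2) * X₀ i ^ 2 ≤ ∑ j, (1 / 2) * X₀ j ^ 2 :=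
      Finset.single_le_sum (f := fun j => (1 / 2) * X₀ j ^ 2) (fun j _ => by positivity)
        (Finset.mem_univ i)
    split_ifs
    · exact div_le_div_of_nonneg_right hsum (by positivity)
    · rw [zero_div]
      positivity

end BarrierSoundness

end Summit.NavierStokesRegularity.NavierStokesRegularity.Theorems

end
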